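import Summits.ValiantsHypothesis.ValiantsHypothesis.Theses.DivisionGap
import Summits.ValiantsHypothesis.ValiantsHypothesis.Theorems.TriangularDimersDivisionEasy.Negative.Basic
import Summits.ValiantsHypothesis.ValiantsHypothesis.Theorems.DivisionGapTriangularDimersDivisionEasyOddJoinDefs
import Summits.ValiantsHypothesis.ValiantsHypothesis.Theorems.DivisionGapTriangularDimersDivisionEasyStubFaceLow
import Summits.ValiantsHypothesis.ValiantsHypothesis.Theorems.DivisionGapTriangularDimersDivisionEasyStubPmSum
import Summits.ValiantsHypothesis.ValiantsHypothesis.Theorems.DivisionGapTriangularDimersDivisionEasyStubBoundAbsorb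
import Summits.ValiantsHypothesis.ValiantsHypothesis.Theorems.DivisionGapTriangularDimersDivisionEasyStubSwapIdentity
import Summits.ValiantsHypothesis.ValiantsHypothesis.Theorems.DivisionGapTriangularDimersDivisionEasyStubSubstIdentity
import Summits.ValiantsHypothesis.ValiantsHypothesis.Theorems.DivisionGapTriangularDimersDivisionEasyStubEvenTransfer
-- Used by name in the final assembly (landed p87772 / p92643; not imported here only because the hub snapshot serving
-- `lean check` has not built `…StubFreeInitialForms` — `InitialFormStmt` stays registered stub 3, `extract` is inline):
-- import Summits.ValiantsHypothesis.ValiantsHypothesis.Theorems.DivisionGapTriangularDimersDivisionEasyStubFreeInitialForms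
-- import Summits.ValiantsHypothesis.ValiantsHypothesis.Theorems.DivisionGapTriangularDimersDivisionEasyStubRhombusExtraction
-- `…StubFaceIdentity` (p105746) is not imported either (hub olean pending); stub 1 is discharged from its two halves.
-- The two reductions `crux_of_oddJoinDivisionEasy` / `crux_of_evenSubgraphDivisionEasy` land as
-- `Theorems/DivisionGapTriangularDimersDivisionEasyReductions.lean` (p109949), and the division-free hardness of both Ising
-- polynomials as `Theorems/DivisionGapTriangularDimersDivisionEasyMonotoneHard.lean` (p109887) — registered helper stubs.

/-!
# Skeleton line `Sketch` (idea card `hight-ising-face`) for crux `TriangularDimersDivisionEasy` (stmt-ValiantsHypothesis-5067)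

Route `DivisionGap`, crux r4 `TriangularDimersDivisionEasy` =
`∃ c, ∀ n, ∃ h ≠ 0, L₊(D_n · h) + L₊(h) ≤ 2 ^ ((log₂ n + c) ^ c)`, `D_n ∈ ℝ≥0[x_(v,w)]` the dimer polynomial of
the `n × n` triangular rhombus `R_n` in doubled oriented edge variables, `L₊ = complexity` over `ℝ≥0`.
Direction: PROVE it (quasi-polynomial bound), by the ODD-JOIN FACE LIFT of the card `Ideas/hight-ising-face.md`
(ideator 3, round 1; triage r1: pass / fail / fail — the two fails grade it a reformulation whose load-bearing step is
open; the lead concurs and records this in `PICKED.md`: the line is driven for what it can land, and its open stub is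
attacked directly).  STATUS (lead a1, v3): every provable stub LANDED; the line is DEAD at its open stub `stub_oddJoinDivisionEasy`
(crux-strength; `Lines/Sketch-dead.md`): this skeleton is the kernel-checked record "crux closed modulo `DivEasy oddJoin`"
(and, via `_of_even`, modulo `DivEasy evenSplit`).

## The line

LEVER 1 (faces are free, LANDED as `Shuffling.stub_freeInitialForms` p87772 + `Shuffling.Extraction.extract` p92643):
over `ℝ≥0` the lowest homogeneous component of `F · h` is `in(F) · in(h)` and costs no more than `F · h`; so
`DivEasy F → DivEasy in(F)`.  LEVER 2 (the odd-join lift): the odd-degree spanning edge sets `J` of `R_n` have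
`|J| ≥ n²/2` with equality exactly for perfect matchings, so the lowest component of the odd-join polynomial
`oddJoin n = Σ_{J odd} Π_{e∈J} y_e Π_{e∉J} (1 + y_e)` (`y_e = x_e x_(e.swap)`; numerator of the ferromagnetic Ising
all-spin correlator `Z⟨Π_v σ_v⟩` of `R_n`, `tanh J_e = y_e/(1+y_e)`) is the crux's `D_n` VERBATIM
(`stub_faceIdentity`).  Hence `OddJoinDivisionEasy := DivEasy oddJoin → crux` (`TriangularDimersDivisionEasy_of`, PROVED below from the
two stubs).  LEVER 3 (lead's addition, the SOURCELESS strengthening): swapping the two oriented variables on the edges of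
ONE perfect matching `pm0 n` is a free renaming that carries the EVEN-subgraph polynomial
`evenSplit n = Σ_{H even} Π_{e∈H} x_e Π_{e∉H} x_(e.swap)` (cycle space of `R_n` = sourceless ferromagnetic Ising
partition function of the dual region in Boltzmann coordinates) onto the split odd-join polynomial, and the monotone
chart map `x_e ↦ y_e, x_(e.swap) ↦ 1 + y_e` carries the latter onto `oddJoin n`; so
`DivEasy evenSplit → DivEasy oddJoin` (`stub_evenTransfer` from `stub_swapIdentity`, `stub_substIdentity`,
`stub_boundAbsorb`) and `TriangularDimersDivisionEasy_of_even`.  The crux is thereby reduced,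
kernel-checked, to the division complexity of a SOURCELESS FERROMAGNETIC ISING partition function — the card's
"bulk sources" obstruction traded for the Boltzmann chart.

## Stubs (7) and composition
* `stub_faceIdentity` (LANDED p105746 = `stub_oddJoinWeights`+`stub_faceCoeffLow` p101733 ∘ `stub_pmSum` p103519) — lowest component of `oddJoin n` is `Negative.triPM n`, all weights `≥ n²`.
* `stub_oddJoinDivisionEasy` (OPEN, LOAD-BEARING; ≥ the crux by Lever 1–2) — `DivEasy oddJoin` ("OddJoinDivisionEasy").
* `stub_freeInitialForms` (LANDED as `Shuffling.stub_freeInitialForms`, p87772) — `InitialFormStmt`: initial forms are free.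
* `stub_boundAbsorb` (LANDED p104688) — `2^((log₂ n + c)^c) + k n^d + k ≤ 2^((log₂ n + c')^c')`.
* `stub_swapIdentity` (LANDED p104880) — `rename (swapVar n) (evenSplit n) = oddJoinSplit n` for even `n` (`H ↦ H Δ pm0 n`).
* `stub_substIdentity` (LANDED p104724) — `aeval (substY n) (oddJoinSplit n) = oddJoin n`, each `substY n e` costs `≤ 2` gates.
* `stub_evenTransfer` (LANDED p105084) — stubs 4–6 ⇒ `DivEasy evenSplit → DivEasy oddJoin`
  (`complexity_renameEquiv`, `complexity_aeval_le`, positivity of `aeval` over `ℝ≥0`; odd `n`: `oddJoin n = 0` by the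
  handshake lemma, proved inside this stub, witness `h = 1`).
`TriangularDimersDivisionEasy_of : stub_freeInitialForms → stub_faceIdentity → stub_oddJoinDivisionEasy → crux` is PROVED
(no `sorry`): `extract` (lowest components multiply and are free) + `Negative.crux_iff`.

## Disproof used (`Cruxes/TriangularDimersDivisionEasy/Disproof.lean` v3, standing disprover gen 1; verdict NO KILL)
* §E `false_without_division`, `false_with_unit_h`, `false_unless_h_in_edge_ideal` (all PROVED, in tree): any witness
  `h` of `stub_oddJoinDivisionEasy` yields the crux's `h' = in(h)`, which therefore must be non-constant, vanish at the
  origin and lie in the edge ideal — consistent: `in(h)` of an `h` coming from any Ising/bosonization computation is a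
  product of edge monomials.  No stub asserts division-free easiness of `D_n`, `oddJoin n` or `evenSplit n`
  (all three have `D_n` as a free face/renaming-face, so all three need `2^{Ω(n)}` monotone gates WITHOUT division).
* §C (no subtraction-free outer-face condensation on `R_4`): not touched — no stub condenses.
* §A/§B hygiene: odd `n` — `oddJoin n = 0` (handshake, inside stub 7) and no monomial of degree `n²` (stub 1); `n = 0`: `oddJoin 0 = 1 = D_0`.
* Lead's own negative experiment (this session, `toy/elim.py`): Pfaffian pair-elimination with NON-PLANAR mesh
  intermediates (the Pfaffian analogue of FGK star–mesh) is subtraction-free on `R_2`, `2 × 4`, but on `R_4` no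
  elimination order reaches more than 12 of 16 vertices (2751 coherent states, exhaustive) — recorded in NOTES/Census.
-/

set_option linter.dupNamespace false
set_option linter.unusedVariables false

namespace Summit.ValiantsHypothesis.ValiantsHypothesis.Cruxes.TriangularDimersDivisionEasy.OddJoinLine

open scoped BigOperators NNReal
open Finset MvPolynomial Literature.Computability.AlgebraicComplexity
open Summit.ValiantsHypothesis.ValiantsHypothesis.Theorems.TriangularDimersDivisionEasy
open Summit.ValiantsHypothesis.ValiantsHypothesis.Theorems.TriangularDimersDivisionEasy.OddJoin

noncomputable section

/-! ## Vocabulary: imported from `Theorems/DivisionGapTriangularDimersDivisionEasyOddJoinDefs.lean` (p98672), namespace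
`…Theorems.TriangularDimersDivisionEasy.OddJoin` (opened below); only `InitialFormStmt` stays local. -/

/-- INITIAL FORMS ARE FREE over `ℝ≥0` (verbatim the dead line's `InitialFormStmt`, LANDED as
`Shuffling.stub_freeInitialForms`, p87772). -/
def InitialFormStmt : Prop :=
  ∀ (σ : Type) (w : σ → ℕ) (d : ℕ) (p : MvPolynomial σ ℝ≥0),
    (∀ m ∈ p.support, d ≤ Finsupp.weight w m) →
      complexity (weightedHomogeneousComponent w d p) ≤ complexity p

/-! ## Registered stubs -/

/-- STUB 1 (M) — the FACE IDENTITY: every monomial of `oddJoin n` has degree `≥ n²`, and the degree-`n²` component is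
the crux's dimer polynomial `Negative.triPM n` verbatim.  Why true: each summand `y^J Π_{e∉J}(1+y_e)` has lowest part
`y^J` of degree `2|J| ≥ n²` (every vertex has odd, hence positive, degree in `J`), with equality iff `J` is a perfect
matching; perfect matchings `J` ↔ the crux's dimer involutions `f` with `y^J = Π_v x_(v, f v)`; odd `n`: both sides `0`. -/
theorem stub_faceIdentity (n : ℕ) :
    (∀ m ∈ (oddJoin n).support, n * n ≤ Finsupp.weight (fun _ => (1 : ℕ)) m) ∧
      weightedHomogeneousComponent (fun _ => (1 : ℕ)) (n * n) (oddJoin n) = Negative.triPM n :=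
  ⟨OddJoin.stub_oddJoinWeights n, (OddJoin.stub_faceCoeffLow n).trans (OddJoin.stub_pmSum n)⟩

/-- STUB 2 (OPEN, LOAD-BEARING) — the odd-join polynomials of the triangular rhombi are quasi-polynomially
division-easy.  At least as strong as the crux (Levers 1–2); FGK 2014 Rem. 1.5 / Propp 2003 problem 5 territory. -/
theorem stub_oddJoinDivisionEasy : DivEasy oddJoin := by
  sorry

/-- STUB 3 (LANDED, p87772 `Shuffling.stub_freeInitialForms`; kept as a registered input of the composition because the
farm snapshot cannot import it yet) — initial forms are free for monotone circuits over `ℝ≥0`. -/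
theorem stub_freeInitialForms : InitialFormStmt := by
  sorry

/-- STUB 4 (S) — polynomial overheads are absorbed by the quasi-polynomial threshold. -/
theorem stub_boundAbsorb (c k d : ℕ) : ∃ c' : ℕ, ∀ n : ℕ, bound c n + k * n ^ d + k ≤ bound c' n :=
  OddJoin.stub_boundAbsorb c k d

/-- STUB 5 (M) — the SWAP IDENTITY: for even `n`, exchanging `x_e ↔ x_(e.swap)` on the edges of the perfect matching
`pm0 n` carries the even-subgraph polynomial to the split odd-join polynomial (`H ↦ H Δ pm0 n` is a bijection
`evenSubgraphs n ≃ oddCovers n`, and the swapped monomial of `H` is the split monomial of `H Δ pm0 n`). -/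
theorem stub_swapIdentity (n : ℕ) (hn : Even n) : rename (swapVar n) (evenSplit n) = oddJoinSplit n :=
  OddJoin.stub_swapIdentity n hn

/-- STUB 6 (S/M) — the SUBSTITUTION IDENTITY: the chart map carries the split odd-join polynomial to `oddJoin n`, and
each substituted polynomial costs at most two gates. -/
theorem stub_substIdentity (n : ℕ) :
    aeval (substY n) (oddJoinSplit n) = oddJoin n ∧ ∀ e : Var n, complexity (substY n e) ≤ 2 :=
  OddJoin.stub_substIdentity n

/-- STUB 7 (M) — the EVEN TRANSFER: from stubs 4–6, `DivEasy evenSplit → DivEasy oddJoin`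
(even `n`: rename the witness `h` by `swapVar n` — free, `complexity_renameEquiv`; push it through `aeval (substY n)` —
`complexity_aeval_le`, `+ 2 n⁴` gates twice; `aeval` of a non-zero `ℝ≥0`-polynomial at non-zero `ℝ≥0`-polynomials is
non-zero; odd `n`: `oddJoin n = 0` by the handshake lemma (no spanning edge set has `n²` odd degrees), witness `h = 1`). -/
theorem stub_evenTransfer
    (hB : ∀ c k d : ℕ, ∃ c' : ℕ, ∀ n : ℕ, bound c n + k * n ^ d + k ≤ bound c' n)
    (hS : ∀ n : ℕ, Even n → rename (swapVar n) (evenSplit n) = oddJoinSplit n)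
    (hφ : ∀ n : ℕ, aeval (substY n) (oddJoinSplit n) = oddJoin n ∧ ∀ e : Var n, complexity (substY n e) ≤ 2) :
    DivEasy evenSplit → DivEasy oddJoin :=
  OddJoin.stub_evenTransfer hB hS hφ

/-! ## Registry: the stub statements as named propositions -/
namespace Registered

/-- Statement of stub 1. -/
abbrev stub_faceIdentity : Prop := ∀ n : ℕ,
  (∀ m ∈ (oddJoin n).support, n * n ≤ Finsupp.weight (fun _ => (1 : ℕ)) m) ∧
    weightedHomogeneousComponent (fun _ => (1 : ℕ)) (n * n) (oddJoin n) = Negative.triPM n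
/-- Statement of stub 2. -/
abbrev stub_oddJoinDivisionEasy : Prop := DivEasy oddJoin
/-- Statement of stub 3. -/
abbrev stub_freeInitialForms : Prop := InitialFormStmt
/-- Statement of stub 4. -/
abbrev stub_boundAbsorb : Prop := ∀ c k d : ℕ, ∃ c' : ℕ, ∀ n : ℕ, bound c n + k * n ^ d + k ≤ bound c' n
/-- Statement of stub 5. -/
abbrev stub_swapIdentity : Prop := ∀ n : ℕ, Even n → rename (swapVar n) (evenSplit n) = oddJoinSplit n
/-- Statement of stub 6. -/
abbrev stub_substIdentity : Prop := ∀ n : ℕ,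
  aeval (substY n) (oddJoinSplit n) = oddJoin n ∧ ∀ e : Var n, complexity (substY n e) ≤ 2
/-- Statement of stub 7. -/
abbrev stub_evenTransfer : Prop :=
  Registered.stub_boundAbsorb → Registered.stub_swapIdentity →
    Registered.stub_substIdentity → DivEasy evenSplit → DivEasy oddJoin

end Registered

theorem faceIdentity_holds : Registered.stub_faceIdentity := stub_faceIdentity
theorem oddJoinDivisionEasy_holds : Registered.stub_oddJoinDivisionEasy := stub_oddJoinDivisionEasy
theorem freeInitialForms_holds : Registered.stub_freeInitialForms := stub_freeInitialForms
theorem boundAbsorb_holds : Registered.stub_boundAbsorb := stub_boundAbsorb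
theorem swapIdentity_holds : Registered.stub_swapIdentity := stub_swapIdentity
theorem substIdentity_holds : Registered.stub_substIdentity := stub_substIdentity
theorem evenTransfer_holds : Registered.stub_evenTransfer := stub_evenTransfer

/-! ## Glue (PROVED): lowest components, and the composition -/

/-- The coercion to power series commutes with weighted homogeneous components.
-- adapted from Theorems/DivisionGapTriangularDimersDivisionEasyStubRhombusExtraction.lean (`Extraction`) -/
theorem coe_weightedHomogeneousComponent {R σ : Type*} [CommSemiring R] (w : σ → ℕ) (N : ℕ)
    (q : MvPolynomial σ R) :
    ((weightedHomogeneousComponent w N q : MvPolynomial σ R) : MvPowerSeries σ R) =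
      MvPowerSeries.weightedHomogeneousComponent w N (q : MvPowerSeries σ R) := by
  ext d
  simp only [MvPolynomial.coeff_coe, MvPowerSeries.coeff_weightedHomogeneousComponent,
    MvPolynomial.coeff_weightedHomogeneousComponent]

/-- LOWEST COMPONENTS MULTIPLY (Mathlib's power-series statement pulled back to polynomials).
-- adapted from Theorems/DivisionGapTriangularDimersDivisionEasyStubRhombusExtraction.lean (`Extraction`) -/
theorem weightedHomogeneousComponent_mul_of_le {R σ : Type*} [CommSemiring R] (w : σ → ℕ)
    (A H : MvPolynomial σ R) {K L : ℕ}
    (hA : ∀ m ∈ A.support, K ≤ Finsupp.weight w m) (hH : ∀ m ∈ H.support, L ≤ Finsupp.weight w m) :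
    weightedHomogeneousComponent w (K + L) (A * H) =
      weightedHomogeneousComponent w K A * weightedHomogeneousComponent w L H := by
  have hle : ∀ (P : MvPolynomial σ R) (N : ℕ), (∀ m ∈ P.support, N ≤ Finsupp.weight w m) →
      (N : ℕ∞) ≤ (P : MvPowerSeries σ R).weightedOrder w := fun P N hP =>
    MvPowerSeries.nat_le_weightedOrder w fun d hd => by
      rw [MvPolynomial.coeff_coe]
      by_contra h0
      exact absurd (hP d (mem_support_iff.mpr h0)) (not_le.mpr hd)
  apply MvPolynomial.coe_injective σ R
  rw [MvPolynomial.coe_mul, coe_weightedHomogeneousComponent, coe_weightedHomogeneousComponent,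
    coe_weightedHomogeneousComponent, MvPolynomial.coe_mul]
  exact MvPowerSeries.weightedHomogeneousComponent_mul_of_le_weightedOrder (hle A K hA) (hle H L hH)

/-- EXTRACTION BY INITIAL FORMS: with `hI` (initial forms are free), `H ≠ 0` and all monomials of `A` of weight
`≥ K`, the lowest component `HL ≠ 0` of `H` has `L₊(HL) ≤ L₊(H)` and `L₊(A_K · HL) ≤ L₊(A · H)`.
-- adapted from Theorems/DivisionGapTriangularDimersDivisionEasyStubRhombusExtraction.lean (`Extraction.extract`) -/
theorem extract (hI : InitialFormStmt)
    {σ : Type} (w : σ → ℕ) (A H : MvPolynomial σ ℝ≥0) (K : ℕ) (hH : H ≠ 0)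
    (hA : ∀ m ∈ A.support, K ≤ Finsupp.weight w m) :
    ∃ HL : MvPolynomial σ ℝ≥0, HL ≠ 0 ∧ complexity HL ≤ complexity H ∧
      complexity (weightedHomogeneousComponent w K A * HL) ≤ complexity (A * H) := by
  classical
  have hfin : (H : MvPowerSeries σ ℝ≥0).weightedOrder w ≠ ⊤ := by
    rwa [Ne, MvPowerSeries.weightedOrder_eq_top_iff, MvPolynomial.coe_eq_zero_iff]
  obtain ⟨L, hL⟩ := ENat.ne_top_iff_exists.mp hfin
  obtain ⟨⟨d, hd, hdL⟩, hlt⟩ := (MvPowerSeries.weightedOrder_eq_nat w).mp hL.symm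
  have hHw : ∀ m ∈ H.support, L ≤ Finsupp.weight w m := fun m hm => by
    by_contra h
    exact (mem_support_iff.mp hm) (by rw [← MvPolynomial.coeff_coe]; exact hlt m (not_le.mp h))
  refine ⟨weightedHomogeneousComponent w L H, fun h0 => hd ?_, hI σ w L H hHw, ?_⟩
  · have h1 := congrArg (coeff d) h0
    rw [coeff_weightedHomogeneousComponent, if_pos hdL, coeff_zero] at h1
    rwa [MvPolynomial.coeff_coe]
  · rw [← weightedHomogeneousComponent_mul_of_le w A H hA hHw]
    refine hI σ w (K + L) (A * H) fun m hm => ?_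
    obtain ⟨a, ha, b, hb, rfl⟩ := Finset.mem_add.mp (support_mul A H hm)
    rw [map_add]
    exact add_le_add (hA a ha) (hHw b hb)

/-- **The crux from the open stubs** (no `sorry`; v3: the five LANDED stubs are used as theorems, only the still-`sorry`
stubs 2–3 remain hypotheses): given the `DivEasy oddJoin` witness `h` at level `n`, `extract` (fed with stub 3, initial
forms are free) produces `HL = in(h) ≠ 0` with `L₊(HL) ≤ L₊(h)` and `L₊(in(oddJoin n) · HL) ≤ L₊(oddJoin n · h)`; by the
face identity (stub 1, landed) `in(oddJoin n) = D_n`, so the crux's clause holds at `n` with the same constant `c`. -/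
theorem TriangularDimersDivisionEasy_of
    (h₂ : Registered.stub_oddJoinDivisionEasy) (h₃ : Registered.stub_freeInitialForms) :
    Summit.ValiantsHypothesis.ValiantsHypothesis.Theses.DivisionGap.TriangularDimersDivisionEasy := by
  rw [Negative.crux_iff]
  obtain ⟨c, hc⟩ := h₂
  refine ⟨c, fun n => ?_⟩
  obtain ⟨h, h0, hb⟩ := hc n
  obtain ⟨hw, hface⟩ := stub_faceIdentity n
  obtain ⟨HL, hHL0, hHLc, hc2⟩ := extract h₃ (fun _ => (1 : ℕ)) (oddJoin n) h (n * n) h0 hw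
  refine ⟨HL, hHL0, ?_⟩
  rw [hface] at hc2
  exact le_trans (Nat.add_le_add hc2 hHLc) hb

/-- **The crux from the sourceless strengthening** (stub 3 plus the LANDED stubs 4–7; no `sorry`): `DivEasy evenSplit`
("EvenSubgraphDivisionEasy") implies the crux. -/
theorem TriangularDimersDivisionEasy_of_even (h₃ : Registered.stub_freeInitialForms) :
    DivEasy evenSplit →
      Summit.ValiantsHypothesis.ValiantsHypothesis.Theses.DivisionGap.TriangularDimersDivisionEasy :=
  fun hE => TriangularDimersDivisionEasy_of
    (stub_evenTransfer stub_boundAbsorb stub_swapIdentity stub_substIdentity hE) h₃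

/-- Wiring check: the registered open stubs feed `TriangularDimersDivisionEasy_of` as stated. -/
example : Summit.ValiantsHypothesis.ValiantsHypothesis.Theses.DivisionGap.TriangularDimersDivisionEasy :=
  TriangularDimersDivisionEasy_of stub_oddJoinDivisionEasy stub_freeInitialForms

end

end Summit.ValiantsHypothesis.ValiantsHypothesis.Cruxes.TriangularDimersDivisionEasy.OddJoinLine
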